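import Mathlib
import Summits.Ventures.HodgeRepro2.T5RecordDifferentTower
import Summits.Ventures.HodgeRepro2.T5SexticGaloisCMDiscriminant

/-!
# A prime unramified in a number field does not divide its discriminant

Tier-5 support N3 / §G-N4.2 (seat p3, gen 87). The lattice-model statement of §N3.10.3 (file 331) and the joint
statement (file 356) are read at places `v` of `K⁺` with `disc K ∉ v`. The record has this condition as a numeral on
the cyclotomic toy fields (`disc ℚ(ζ₇) = −7⁵`, `disc ℚ(i) = −4`) but NOT for a subfield given abstractly (the
non-cyclotomic sextic `F = ℚ(ζ₂₁)^{⟨σ₁₃⟩}`, whose unramifiedness at `p ∤ 21` IS in the record, file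
`T5CyclotomicUnramified`). This file supplies the missing bridge in general:

* `not_dvd_absNorm_of_sup_eq_top` — for an ideal `I ≠ ⊥` of a Dedekind domain finite over `ℤ` with `I + (p) = (1)`:
  `p ∤ N(I)` (Cauchy on the finite quotient `S/I`: a `p`-torsion element would be killed by the unit `p`);
* `sup_eq_top_of_forall_not_dvd` — if no prime containing `p` divides `I` then `I + (p) = (1)`;
* **`not_dvd_natAbs_discr_of_forall_ramificationIdx_eq_one`** — if every prime `w` of `𝓞_K` above `p` has
  `e(w/p) = 1` then `p ∤ |disc K|` (Mathlib's `absNorm (𝔇_{K/ℤ}) = |disc K|` and the record's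
  `ramificationIdx_int_eq_one_iff`: `w ∤ 𝔇 ⟺ e(w/p) = 1`);
* **`discr_notMem_of_forall_ramificationIdx_eq_one`** — the same read at a place `v` of `K⁺` above `(p)`:
  `disc K ∉ v` (through the record's `T5SexticGaloisCMDiscriminant.discr_notMem_of_not_dvd_discr`);
* `liesOver_int_of_mem` — a place of a number field containing `p` lies over `(p) ⊂ ℤ` (the contraction is a
  prime containing the maximal ideal `(p)`).

§8(d): uses an L-value-free non-vanishing device: NO.
-/

open IsDedekindDomain IsDedekindDomain.HeightOneSpectrum NumberField
open Summit.Ventures.HodgeRepro2.T5RecordDifferentTower Summit.Ventures.HodgeRepro2.T5SexticGaloisCMDiscriminant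

namespace Summit.Ventures.HodgeRepro2.T5DiscriminantUnramified

section Dedekind

variable {S : Type*} [CommRing S] [IsDedekindDomain S] [Module.Free ℤ S] [Module.Finite ℤ S]

/-- **`p ∤ N(I)` when `I + (p) = (1)`**: the finite quotient `S/I` has no `p`-torsion, because `p` is a unit modulo
`I` (`1 = a + p c` with `a ∈ I`); by Cauchy's theorem `p ∤ |S/I| = N(I)`. -/
theorem not_dvd_absNorm_of_sup_eq_top (I : Ideal S) (hI : I ≠ ⊥) (p : ℕ) [hp : Fact p.Prime]
    (h : I ⊔ Ideal.span {(p : S)} = ⊤) : ¬ p ∣ Ideal.absNorm I := by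
  intro hdvd
  haveI : Finite (S ⧸ I) := Ideal.finiteQuotientOfFreeOfNeBot I hI
  rw [Ideal.absNorm_apply, Submodule.cardQuot_apply] at hdvd
  obtain ⟨x, hx⟩ := exists_prime_addOrderOf_dvd_card' p hdvd
  have hpx : (p : S ⧸ I) * x = 0 := by
    rw [← nsmul_eq_mul, ← hx]
    exact addOrderOf_nsmul_eq_zero x
  have h1 : (1 : S) ∈ I ⊔ Ideal.span {(p : S)} := by rw [h]; exact Submodule.mem_top
  obtain ⟨a, ha, b, hb, hab⟩ := Submodule.mem_sup.mp h1
  obtain ⟨c, rfl⟩ := Ideal.mem_span_singleton.mp hb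
  have hx0 : x = 0 := by
    calc x = Ideal.Quotient.mk I 1 * x := by rw [map_one, one_mul]
      _ = (Ideal.Quotient.mk I a + Ideal.Quotient.mk I ((p : S) * c)) * x := by rw [← map_add, hab]
      _ = Ideal.Quotient.mk I c * ((p : S ⧸ I) * x) := by
          rw [Ideal.Quotient.eq_zero_iff_mem.mpr ha, zero_add, map_mul, map_natCast]
          ring
      _ = 0 := by rw [hpx, mul_zero]
  rw [hx0, addOrderOf_zero] at hx
  exact hp.out.one_lt.ne hx

omit [Module.Free ℤ S] [Module.Finite ℤ S] in
/-- If no prime ideal containing `p` divides `I`, then `I + (p) = (1)` (a maximal ideal above `I + (p)` would be such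
a prime). -/
theorem sup_eq_top_of_forall_not_dvd (I : Ideal S) (p : ℕ)
    (h : ∀ P : Ideal S, P.IsPrime → (p : S) ∈ P → ¬ P ∣ I) : I ⊔ Ideal.span {(p : S)} = ⊤ := by
  by_contra hne
  obtain ⟨M, hM, hle⟩ := Ideal.exists_le_maximal _ hne
  have hI : I ≤ M := le_trans le_sup_left hle
  have hpM : (p : S) ∈ M := hle (Ideal.mem_sup_right (Ideal.mem_span_singleton_self _))
  exact h M hM.isPrime hpM (Ideal.dvd_iff_le.mpr hI)

end Dedekind

section LiesOver

variable {F : Type*} [Field F] (p : ℕ) [hp : Fact p.Prime]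

/-- A place `w` of a number field `F` with `p ∈ w` lies over `(p) ⊂ ℤ`. -/
theorem liesOver_int_of_mem (w : HeightOneSpectrum (𝓞 F)) (h : (p : 𝓞 F) ∈ w.asIdeal) :
    w.asIdeal.LiesOver (Ideal.span {(p : ℤ)}) := by
  refine ⟨?_⟩
  have hprime : (w.asIdeal.under ℤ).IsPrime := Ideal.IsPrime.under ℤ w.asIdeal
  have hpmax : (Ideal.span {(p : ℤ)}).IsMaximal :=
    ((Ideal.span_singleton_prime (by exact_mod_cast hp.out.ne_zero)).mpr
      (Nat.prime_iff_prime_int.mp hp.out)).isMaximal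
      (Ideal.span_singleton_eq_bot.not.mpr (by exact_mod_cast hp.out.ne_zero))
  refine hpmax.eq_of_le hprime.ne_top ?_
  rw [Ideal.span_le, Set.singleton_subset_iff, SetLike.mem_coe, Ideal.mem_under, map_natCast]
  exact h

end LiesOver

section NumberField

variable (K : Type*) [Field K] [NumberField K] (p : ℕ) [hp : Fact p.Prime]

/-- **A prime unramified in `K` does not divide `|disc K|`**: if every prime `w` of `𝓞_K` containing `p` has
`e(w/p) = 1`, then `p ∤ |disc K| = N(𝔇_{K/ℤ})` (no such `w` divides the different, so `𝔇 + (p) = (1)`). -/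
theorem not_dvd_natAbs_discr_of_forall_ramificationIdx_eq_one
    (h : ∀ w : HeightOneSpectrum (𝓞 K), (p : 𝓞 K) ∈ w.asIdeal → w.asIdeal.ramificationIdx ℤ = 1) :
    ¬ p ∣ (discr K).natAbs := by
  rw [← NumberField.absNorm_differentIdeal K (𝓞 K)]
  refine not_dvd_absNorm_of_sup_eq_top _ differentIdeal_ne_bot p
    (sup_eq_top_of_forall_not_dvd _ p fun P hP hpP hdvd => ?_)
  have hPne : P ≠ ⊥ := by
    intro hb
    rw [hb, Ideal.mem_bot] at hpP
    exact Nat.cast_ne_zero.mpr hp.out.ne_zero hpP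
  exact (ramificationIdx_int_eq_one_iff K ⟨P, hP, hPne⟩).mpr (h ⟨P, hP, hPne⟩ hpP) hdvd

/-- **`disc K ∉ v`** for a place `v` of `K⁺` above `(p)`, when `p` is unramified in `K`
(`p ∤ |disc K|` and the record's `discr_notMem_of_not_dvd_discr`). -/
theorem discr_notMem_of_forall_ramificationIdx_eq_one
    (h : ∀ w : HeightOneSpectrum (𝓞 K), (p : 𝓞 K) ∈ w.asIdeal → w.asIdeal.ramificationIdx ℤ = 1)
    (v : HeightOneSpectrum (𝓞 (maximalRealSubfield K))) [v.asIdeal.LiesOver (Ideal.span {(p : ℤ)})] :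
    ((discr K : ℤ) : 𝓞 (maximalRealSubfield K)) ∉ v.asIdeal :=
  discr_notMem_of_not_dvd_discr K p
    (fun hd => not_dvd_natAbs_discr_of_forall_ramificationIdx_eq_one K p h (Int.natCast_dvd.mp hd)) v

end NumberField

end Summit.Ventures.HodgeRepro2.T5DiscriminantUnramified
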